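import Mathlib
import Summits.Ventures.PercRepro2.CoinChainXAGateHull4
import Summits.Ventures.PercRepro2.CoinChainXAGateHullGen
import Summits.Ventures.PercRepro2.CoinChainXASixGateJGen

/-!
# The six-cell sub-case of (XA′) on the convex hull of FIVE gates, ARBITRARY coin-entered set
(blind cell PercRepro2, night-2 g27; proofs/NIGHT2-DARC.md §68.14)

`chain_XA'_six_gate_hull4_gen`: for `ent = {m}`, ANY `ent' ∋ j`, entry markers, every gate
`d' = θ₁·d·1[{m, j} ⊆ W] + θ₂·d·1[j ∈ W] + θ₃·d·1[m ∈ W] + θ₄·d` (`θᵢ ≥ 0`, `Σθ ≤ 1`) satisfies (XA′).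
-/

namespace Summit.Ventures.PercRepro2.Coin

open Classical

section GateHull4Gen

variable {V : Type*} [DecidableEq V] {R : Type*} [Field R] [LinearOrder R] [IsStrictOrderedRing R]

/-- **(XA′) ON THE CONVEX HULL OF THE FIVE PROVED GATES, ARBITRARY COIN-ENTERED SET**: for every
`d' = θ₁·d·1[{m, j} ⊆ W] + θ₂·d·1[j ∈ W] + θ₃·d·1[m ∈ W] + θ₄·d` with `θᵢ ≥ 0`, `θ₁ + θ₂ + θ₃ + θ₄ ≤ 1`. -/
theorem chain_XA'_six_gate_hull4_gen (U : Finset V) (m j : V) (ent' : Finset V) (hj : j ∈ ent') (ν c d d' : Finset V → R)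
    (hν0 : ∀ W, 0 ≤ ν W) (hν : ∀ s ⊆ U, ∀ t ⊆ U, ν s * ν t ≤ ν (s ∩ t) * ν (s ∪ t))
    (hc0 : ∀ W, 0 ≤ c W) (hd0 : ∀ W, 0 ≤ d W) (hdc : ∀ W, d W ≤ c W)
    (hcc : ∀ s t, c s * c t ≤ c (s ∩ t) * c (s ∪ t))
    (hdd : ∀ s t, d s * d t ≤ d (s ∩ t) * d (s ∪ t))
    (hcd : ∀ s t, c s * d t ≤ c (s ∩ t) * d (s ∪ t))
    (hratio : ∀ s t, s ⊆ t → d s * c t ≤ c s * d t)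
    (θ₁ θ₂ θ₃ θ₄ : R) (hθ₁ : 0 ≤ θ₁) (hθ₂ : 0 ≤ θ₂) (hθ₃ : 0 ≤ θ₃) (hθ₄ : 0 ≤ θ₄) (hθ : θ₁ + θ₂ + θ₃ + θ₄ ≤ 1)
    (hd' : ∀ W, d' W = θ₁ * (if m ∈ W ∧ j ∈ W then d W else 0) + θ₂ * (if j ∈ W then d W else 0)
      + θ₃ * (if m ∈ W then d W else 0) + θ₄ * d W)
    (x y : Finset V → R) (hx : ∀ W, x W = if m ∈ W then 1 else 0)
    (hy : ∀ W, y W = if j ∈ W then 1 else 0) :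
    (((∑ W ∈ U.powerset, ν W * chainMix {m} ent' 0 c d W) * (∑ W ∈ U.powerset, ν W * chainMix {m} ent' 1 c d W * x W) - (∑ W ∈ U.powerset, ν W * chainMix {m} ent' 0 c d W * x W) * (∑ W ∈ U.powerset, ν W * chainMix {m} ent' 1 c d W)) *
          ((∑ W ∈ U.powerset, ν W * chainMix {m} ent' 0 c d W) * (∑ W ∈ U.powerset, ν W * chainMix {m} ent' 0 c d' W * y W) - (∑ W ∈ U.powerset, ν W * chainMix {m} ent' 0 c d W * y W) * (∑ W ∈ U.powerset, ν W * chainMix {m} ent' 0 c d' W))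
        + ((∑ W ∈ U.powerset, ν W * chainMix {m} ent' 0 c d W) * (∑ W ∈ U.powerset, ν W * chainMix {m} ent' 1 c d W * y W) - (∑ W ∈ U.powerset, ν W * chainMix {m} ent' 0 c d W * y W) * (∑ W ∈ U.powerset, ν W * chainMix {m} ent' 1 c d W)) *
          ((∑ W ∈ U.powerset, ν W * chainMix {m} ent' 0 c d W) * (∑ W ∈ U.powerset, ν W * chainMix {m} ent' 0 c d' W * x W) - (∑ W ∈ U.powerset, ν W * chainMix {m} ent' 0 c d W * x W) * (∑ W ∈ U.powerset, ν W * chainMix {m} ent' 0 c d' W))) ≤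
        (∑ W ∈ U.powerset, ν W * chainMix {m} ent' 0 c d W) * ((∑ W ∈ U.powerset, ν W * chainMix {m} ent' 0 c d W) * (∑ W ∈ U.powerset, ν W * chainMix {m} ent' 0 c d W) * (∑ W ∈ U.powerset, ν W * chainMix {m} ent' 1 c d' W * (x W * y W))
          - (∑ W ∈ U.powerset, ν W * chainMix {m} ent' 0 c d W) * (∑ W ∈ U.powerset, ν W * chainMix {m} ent' 0 c d W * y W) * (∑ W ∈ U.powerset, ν W * chainMix {m} ent' 1 c d' W * x W)
          - (∑ W ∈ U.powerset, ν W * chainMix {m} ent' 0 c d W) * (∑ W ∈ U.powerset, ν W * chainMix {m} ent' 0 c d W * x W) * (∑ W ∈ U.powerset, ν W * chainMix {m} ent' 1 c d' W * y W)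
          + (∑ W ∈ U.powerset, ν W * chainMix {m} ent' 0 c d W * x W) * (∑ W ∈ U.powerset, ν W * chainMix {m} ent' 0 c d W * y W) * (∑ W ∈ U.powerset, ν W * chainMix {m} ent' 1 c d' W)) := by
  have hx0 := marker_nonneg m x hx
  have hy0 := marker_nonneg j y hy
  have hxm := marker_mono m x hx
  have hym := marker_mono j y hy
  have ha0 : 0 ≤ ∑ W ∈ U.powerset, ν W * chainMix {m} ent' 0 c d W :=
    Finset.sum_nonneg (fun W _ => mul_nonneg (hν0 W) (chainMix_nonneg _ _ le_rfl zero_le_one hc0 hd0 W))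
  refine chain_XA'_of_gate_mix4 U {m} ent' ν c d (fun W => if m ∈ W ∧ j ∈ W then d W else 0) (fun W => if j ∈ W then d W else 0) (fun W => if m ∈ W then d W else 0) d d' θ₁ θ₂ θ₃ θ₄ hθ₁ hθ₂ hθ₃ hθ₄ hθ
    (fun W => hd' W) x y ?_ ?_ ?_ ?_ ?_
  · exact chain_XA'_six_topgate_gen U m j ent' hj ν c d (fun W => if m ∈ W ∧ j ∈ W then d W else 0) hν0 hν hc0 hd0 hdc hcd (fun W => rfl) x y hx hy
  · exact chain_XA'_six_gateJGen U m j ent' hj ν c d (fun W => if j ∈ W then d W else 0) hν0 hν hc0 hd0 hdc hcc hdd hcd (fun W => rfl) x y hx hy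
  · refine chain_XA'_of_gate_on_De U {m} ent' ν c d (fun W => if m ∈ W then d W else 0) ?_ ha0 x y ?_
    · intro W h
      obtain ⟨r, hr, hrW⟩ := h
      rw [Finset.mem_singleton] at hr
      subst hr
      simp [hrW]
    · exact chain_world1_mixed_nonneg U {m} ent' ν c d (fun W => if m ∈ W then d W else 0) 0 0 le_rfl zero_le_one le_rfl zero_le_one
        hν0 hν hc0 hd0 (gateM_nonneg m d _ hd0 (fun W => rfl)) hdc
        (fun W => le_trans (gateM_le m d _ hd0 (fun W => rfl) W) (hdc W)) hcc hdd
        (gateM_lsm m d _ hd0 (fun W => rfl) hdd) hcd (gateM_cross m c d _ hc0 hd0 (fun W => rfl) hcd)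
        (gateM_cross m d d _ hd0 hd0 (fun W => rfl) hdd) hratio (gateM_ratio m c d _ hc0 hd0 (fun W => rfl) hratio)
        x y hx0 hy0 hxm hym
  · refine chain_XA'_of_gate_on_De U {m} ent' ν c d d (fun W _ => rfl) ha0 x y ?_
    exact chain_world1_mixed_nonneg U {m} ent' ν c d d 0 0 le_rfl zero_le_one le_rfl zero_le_one
      hν0 hν hc0 hd0 hd0 hdc hdc hcc hdd hdd hcd hcd hdd hratio hratio x y hx0 hy0 hxm hym
  · exact chain_XA'_six_zero_gate_gen U m j ent' hj ν c d hν0 hν hc0 hd0 hdc hcd x y hx hy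

end GateHull4Gen

end Summit.Ventures.PercRepro2.Coin
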